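import Summits.QuantumAdvantage.AdviceFreeQNC0.FibreDecimation37
import HarnessLib

/-!
# Cell qa-qnc0, `p = 3` — ROUND-37P2 File A, first proofs: Lemma 37.D0 (`LfunChiDirLaw`) and the §3.5 exclusion step (`MixedExcludes`)

Planner qa-qnc0-p2 g37 typed (`FibreDecimation37.lean`, ported verbatim by qn-prover-3 g23) the targets of ROUND-37P2; this file proves the two
that are pure algebra / letter bookkeeping:

* **`lfunChiDirLaw : LfunChiDirLaw`** (Lemma 37.D0) — the dual-basis functional `L_a` (`WalkExactLaw.Lfun`) on a GENERAL character
  `χ_δ`, `δ ∈ 𝔽₃^m` with zeros allowed: `L_a(χ_δ) = [δ a-compatible] · ∏_{i : δ_i = 0} ω^{lett(a_i)}`.  Proof: the same product–sum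
  factorisation as `Lfun_chi`; per coordinate `ω^{δ_i} + ω^{lett(¬a_i)}` is `ω^{lett(a_i)}` if `δ_i = 0`, `1` if `δ_i = lett(a_i)`, `0` otherwise.
* **`mixedExcludes : MixedExcludes`** (§3.5) — a row reading `−a` on `M₁` (`|M₁| ≥ 3`) and `a` off `M₁` (`|M ∖ M₁| ≥ 3`) fails the J-condition:
  each of the four compatibility clauses is refuted at a coordinate of the appropriate part other than the shifted one (two suffice).

WHAT THIS IS NOT: Lemma 37.D (i)–(iii), the Markov step and Theorem 37.F/37.F′ (File B) are not attempted here; crux 22907 untouched; no separation.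
-/

noncomputable section

namespace Summit.QuantumAdvantage.AdviceFreeQNC0.Exp37

open Finset
open Summit.QuantumAdvantage.AdviceFreeQNC0 F4

/-! ## Lemma 37.D0 -/

/-- Values in `𝔽₃`. -/
theorem zmod3_cases (d : ZMod 3) : d = 0 ∨ d = 1 ∨ d = 2 := by
  revert d; decide

/-- The per-coordinate factor of `L_a(χ_δ)`: `ω^{δ_i} + ω^{lett(¬a_i)}`. -/
theorem coord_factor (d : ZMod 3) (b : Bool) :
    ω ^ d.val + ω ^ lett (!b) = if d = 0 then ω ^ lett b else if d = lettZ b then 1 else 0 := by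
  have v1 : (1 : ZMod 3).val = 1 := rfl
  have v2 : (2 : ZMod 3).val = 2 := rfl
  have l1 : lettZ false = 1 := by decide
  have l2 : lettZ true = 2 := by decide
  have n10 : (1 : ZMod 3) ≠ 0 := by decide
  have n20 : (2 : ZMod 3) ≠ 0 := by decide
  have n12 : (1 : ZMod 3) ≠ 2 := by decide
  have n21 : (2 : ZMod 3) ≠ 1 := by decide
  rcases zmod3_cases d with rfl | rfl | rfl <;> cases b <;>
    simp only [ZMod.val_zero, v1, v2, l1, l2, lett, Bool.not_false, Bool.not_true, if_true, if_false, Bool.false_eq_true,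
      pow_zero, pow_one, n10, n20, n12, n21]
  · exact one_add_omega_sq
  · exact one_add_omega
  · exact omega_add_omega_sq
  · exact add_self _
  · exact add_self _
  · rw [add_comm]; exact omega_add_omega_sq

/-- **Lemma 37.D0 — PROVED.** -/
theorem lfunChiDirLaw : LfunChiDirLaw := by
  classical
  intro m a δ
  unfold Lfun chiDir
  have e : ∀ u : Fin m → Bool,
      (∏ i, (if u i = true then ω ^ (δ i).val else 1)) * ∏ i, (if u i = true then 1 else ω ^ lett (!a i)) =
        ∏ i, (if u i = true then ω ^ (δ i).val else ω ^ lett (!a i)) := by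
    intro u
    rw [← Finset.prod_mul_distrib]
    refine Finset.prod_congr rfl fun i _ => ?_
    by_cases hu : u i = true <;> simp [hu]
  rw [Finset.sum_congr rfl fun u _ => e u]
  have h := Finset.prod_univ_sum (fun _ : Fin m => (univ : Finset Bool))
    (fun i bb => if bb = true then ω ^ (δ i).val else ω ^ lett (!a i))
  rw [Fintype.piFinset_univ] at h
  rw [← h]
  have hfac : ∀ i, (∑ bb : Bool, if bb = true then ω ^ (δ i).val else ω ^ lett (!a i)) =
      if δ i = 0 then ω ^ lett (a i) else if δ i = lettZ (a i) then 1 else 0 := by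
    intro i
    rw [Fintype.sum_bool]
    simp only [if_true, Bool.false_eq_true, if_false]
    exact coord_factor (δ i) (a i)
  simp_rw [hfac]
  by_cases hc : Compatible a δ
  · rw [if_pos hc, ← Finset.prod_filter_mul_prod_filter_not univ (fun i => δ i = 0)]
    have h1 : ∏ i ∈ univ.filter (fun i => δ i = 0),
        (if δ i = 0 then ω ^ lett (a i) else if δ i = lettZ (a i) then 1 else 0) =
        ∏ i ∈ univ.filter (fun i => δ i = 0), ω ^ lett (a i) :=
      Finset.prod_congr rfl fun i hi => by rw [mem_filter] at hi; rw [if_pos hi.2]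
    have h2 : ∏ i ∈ univ.filter (fun i => ¬ δ i = 0),
        (if δ i = 0 then ω ^ lett (a i) else if δ i = lettZ (a i) then 1 else 0) = 1 :=
      Finset.prod_eq_one fun i hi => by rw [mem_filter] at hi; rw [if_neg hi.2, if_pos (hc i hi.2)]
    rw [h1, h2, mul_one]
  · rw [if_neg hc]
    obtain ⟨i, hi0, hne⟩ : ∃ i, δ i ≠ 0 ∧ δ i ≠ lettZ (a i) := by
      by_contra hall
      push Not at hall
      exact hc fun i hi => hall i hi
    exact Finset.prod_eq_zero (mem_univ i) (by rw [if_neg hi0, if_neg hne])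

/-! ## §3.5 exclusion step -/

/-- Letters are non-zero in `𝔽₃`. -/
theorem lettZ_ne_zero (b : Bool) : lettZ b ≠ 0 := by
  cases b <;> decide

/-- A letter is not its own negative. -/
theorem neg_lettZ_ne (b : Bool) : -lettZ b ≠ lettZ b := by
  cases b <;> decide

/-- **§3.5 exclusion step — PROVED** (two coordinates on each side suffice). -/
theorem mixedExcludes : MixedExcludes := by
  classical
  intro m a M₁ h1 h2 hJ
  obtain ⟨_, hJ⟩ := hJ
  obtain ⟨i₁, hi₁, i₂, hi₂, hi12⟩ := Finset.one_lt_card.1 (show 1 < M₁.card by omega)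
  obtain ⟨j₁, hj₁, j₂, hj₂, hj12⟩ := Finset.one_lt_card.1 (show 1 < (univ \ M₁).card by omega)
  rw [mem_sdiff] at hj₁ hj₂
  rcases hJ with hc | hc | ⟨i, hc | hc⟩
  · -- compatible: fails at `i₁ ∈ M₁`
    have h := hc i₁
    simp only [hi₁, if_true, ne_eq, neg_eq_zero] at h
    exact neg_lettZ_ne _ (h (lettZ_ne_zero _))
  · -- `−δ` compatible: fails at `j₁ ∉ M₁`
    have h := hc j₁
    simp only [Pi.neg_apply, hj₁.2, if_false, ne_eq, neg_eq_zero] at h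
    exact neg_lettZ_ne _ (h (lettZ_ne_zero _))
  · -- `δ + e_i`: fails at an element of `M₁` other than `i`
    obtain ⟨i', hi', hne⟩ : ∃ i' ∈ M₁, i' ≠ i := by
      by_cases h : i₁ = i
      · exact ⟨i₂, hi₂, fun h' => hi12 (h.trans h'.symm)⟩
      · exact ⟨i₁, hi₁, h⟩
    have h := hc i'
    simp only [Pi.add_apply, Pi.single_eq_of_ne hne, add_zero, hi', if_true, ne_eq, neg_eq_zero] at h
    exact neg_lettZ_ne _ (h (lettZ_ne_zero _))
  · -- `−δ + e_i`: fails at an element off `M₁` other than `i`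
    obtain ⟨j', hj', hne⟩ : ∃ j' ∉ M₁, j' ≠ i := by
      by_cases h : j₁ = i
      · exact ⟨j₂, hj₂.2, fun h' => hj12 (h.trans h'.symm)⟩
      · exact ⟨j₁, hj₁.2, h⟩
    have h := hc j'
    simp only [Pi.add_apply, Pi.neg_apply, Pi.single_eq_of_ne hne, add_zero, hj', if_false, ne_eq, neg_eq_zero] at h
    exact neg_lettZ_ne _ (h (lettZ_ne_zero _))

end Summit.QuantumAdvantage.AdviceFreeQNC0.Exp37

end
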